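import Literature.Analysis.FluidPDE.TaoClassSymmetry
import Literature.Analysis.FluidPDE.NSKatoToClayProofs
import Literature.Analysis.FluidPDE.NSLerayHopfSereginEnergyProofs
import Literature.Analysis.FluidPDE.NSCriticalClosureBesovKatoClass
import Literature.Analysis.FluidPDE.AxisymmetricVorticityTransport
import Literature.Analysis.FluidPDE.AxisymmetricEuler
import HarnessLib

/-!
# Route FrozenSignCascade · crux `BoundedEnvelopeContinuation` (stmt-NavierStokesRegularity-10579)
# Axisymmetric special case, step AX0: axisymmetry of the datum propagates

**Theorem (`axisymmetric_of_datum`).** Let `ν > 0` and let `u₀` be a Clay datum (smooth,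
rapidly decaying, divergence free) which is axisymmetric, `u₀ (R_θ x) = R_θ (u₀ x)` for every
rotation `R_θ` about the `x₃`-axis (`IsAxisymmetric`). Let `(u, p)` be a classical solution of
Navier–Stokes on `ℝ³ × [0, T)`, `T > 0`, which is Leray–Hopf from `u₀` with `u 0 = u₀`. Then
every slice `u t`, `t ∈ [0, T)`, is axisymmetric.

**Proof (uniqueness; Majda–Bertozzi 2002, §2.3.3, (2.52)–(2.53): "the solution to the
Navier–Stokes equation will remain axisymmetric").** No spatial decay of `u` is needed:
the classical Leray–Hopf solution is the Kato `C_t L³` solution from `u₀` on `[0, T)`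
(`isKatoSolutionOn_of_classical`, Lemarié-Rieusset 2016, Thm. 15.1 (A)–(B)); for `t < T` and
`Tt = (t + T)/2` there is a Tao-class solution `(u', p')` from `u₀` on the closed slab `[0, Tt]`
(`exists_isTaoSolutionOn_of_isKatoSolutionOn`, von Wahl's regularity of the class `C_t L³`),
which agrees with `u` at every time of `[0, Tt]` a.e. (`IsTaoSolutionOn.ae_eq_of_kato_Icc`,
Furioli–Lemarié-Rieusset–Terraneo uniqueness), hence everywhere (both slices are continuous).
The Tao-class solution is equivariant under every linear isometry fixing the datum
(`IsTaoSolutionOn.conj_eq_of_datum`, Prodi–Serrin uniqueness in Tao's class), in particular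
under the rotations `rotZLIE θ`; unwinding `R_θ (u t (R_{-θ} (R_θ x))) = u t (R_θ x)` with the
group law `rotZ_add`, `rotZ_zero` gives `IsAxisymmetric (u t)`.

This is a `--supports` file for the crux item (lead c4's axisymmetric support skeleton, AX0);
it introduces no definition and no named fact.

Sources: A. J. Majda, A. L. Bertozzi, *Vorticity and Incompressible Flow* (CUP 2002), §2.3.3;
P. G. Lemarié-Rieusset, *The Navier–Stokes problem in the 21st century* (2016), Thm. 15.1,
Prop. 12.3, Thm. 7.7; G. Koch, N. Nadirashvili, G. Seregin, V. Šverák, Acta Math. 203 (2009), §1.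
-/

noncomputable section

set_option linter.dupNamespace false -- nested layout Summit.<S>.<Sub>, Sub = S (D-0017)

open Set MeasureTheory Filter Topology Function
open scoped ENNReal
open Literature.Analysis Literature.Analysis.FluidPDE

namespace Summit.NavierStokesRegularity.NavierStokesRegularity.Theorems.BoundedEnvelope

/-- **AX0 · propagation of axisymmetry to classical Leray–Hopf solutions.** For `ν > 0`, an
axisymmetric Clay datum `u₀` (smooth, rapidly decaying, divergence free), `T > 0` and a classical
solution `(u, p)` on `ℝ³ × [0, T)` which is Leray–Hopf from `u₀` with `u 0 = u₀`, every slice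
`u t`, `0 ≤ t < T`, is axisymmetric. Proof by uniqueness: `u` is the Kato solution
(`isKatoSolutionOn_of_classical`), identified on `[0, (t+T)/2]` with a Tao-class solution
(`exists_isTaoSolutionOn_of_isKatoSolutionOn`, `IsTaoSolutionOn.ae_eq_of_kato_Icc`, continuity
of slices), and Tao-class solutions inherit every isometric symmetry of the datum
(`IsTaoSolutionOn.conj_eq_of_datum` with `rotZLIE θ`).
[cite: MajdaBertozziCUP2002, §2.3.3 (2.52)–(2.53)] -/
theorem axisymmetric_of_datum :
    ∀ ν : ℝ, 0 < ν → ∀ (u₀ : EuclideanSpace ℝ (Fin 3) → EuclideanSpace ℝ (Fin 3)),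
      ContDiff ℝ (⊤ : ℕ∞) u₀ → Literature.Analysis.FluidPDE.HasRapidSpatialDecay u₀ →
      Literature.Analysis.FluidPDE.NSWave0.IsDivFree u₀ →
      Literature.Analysis.FluidPDE.IsAxisymmetric u₀ →
      ∀ T : ℝ, 0 < T → ∀ (u : ℝ → EuclideanSpace ℝ (Fin 3) → EuclideanSpace ℝ (Fin 3))
        (p : ℝ → EuclideanSpace ℝ (Fin 3) → ℝ),
        Literature.Analysis.FluidPDE.IsClassicalNSSolutionOn (Set.Ico 0 T) ν 0 u p →
        Literature.Analysis.FluidPDE.IsLerayHopfOn T ν 0 u₀ u → u 0 = u₀ →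
        ∀ t ∈ Set.Ico 0 T, Literature.Analysis.FluidPDE.IsAxisymmetric (u t) := by
  intro ν hν u₀ hu hd hdiv hax T hT u p hsol hLH hu0 t ht
  -- the classical Leray–Hopf solution is the Kato solution on `[0, T)`
  have hLH' : IsLerayHopfOn T ν 0 (u 0) u := by rw [hu0]; exact hLH
  have hd0 : HasRapidSpatialDecay (u 0) := by rw [hu0]; exact hd
  have hK : IsKatoSolutionOn T ν u₀ u := by
    have h := isKatoSolutionOn_of_classical hν hT hsol hLH' hd0
    rwa [hu0] at h
  -- an intermediate closed slab `[0, Tt]`, `t < Tt < T`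
  set Tt : ℝ := (t + T) / 2 with hTt
  have hTt0 : 0 < Tt := by rw [hTt]; linarith [ht.1, ht.2]
  have htTt : t < Tt := by rw [hTt]; linarith [ht.2]
  have hTtT : Tt < T := by rw [hTt]; linarith [ht.2]
  have htI : t ∈ Icc 0 Tt := ⟨ht.1, htTt.le⟩
  -- the Tao-class state from `u₀` on `[0, Tt]`
  obtain ⟨u', p', hTao⟩ :=
    exists_isTaoSolutionOn_of_isKatoSolutionOn hν hu hdiv hd hK hTt0 hTtT
  -- identification `u' t = u t` (Kato uniqueness, then continuity of both slices)
  have hae : u' t =ᵐ[volume] u t :=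
    hTao.ae_eq_of_kato_Icc hν hTt0 (hK.mild.mono (Ico_subset_Ico_right hTtT.le))
      (hK.continuousInLpOn.mono fun s hs => ⟨hs.1, lt_of_le_of_lt hs.2 hTtT⟩)
      (hK.aestronglyMeasurable.mono_measure (Measure.restrict_mono
        (Set.prod_mono (Ioo_subset_Ioo_right hTtT.le) Subset.rfl) le_rfl)) t htI
  have heq : u' t = u t :=
    (Continuous.ae_eq_iff_eq volume (hTao.classical.contDiff_velocity htI).continuous
      (hsol.contDiff_velocity ht).continuous).1 hae
  -- equivariance of the Tao-class state under the rotations about the axis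
  intro θ x
  have hdat : ∀ y, rotZLIE θ (u₀ ((rotZLIE θ).symm y)) = u₀ y := fun y => by
    simp only [rotZLIE_apply, rotZLIE_symm_apply]
    exact hax.rotZ_apply_rotZ_neg θ y
  have hR := hTao.conj_eq_of_datum (rotZLIE θ) hν hTt0 hdat t htI (rotZ θ x)
  simp only [rotZLIE_apply, rotZLIE_symm_apply] at hR
  rw [← rotZ_add, neg_add_cancel, rotZ_zero, heq] at hR
  exact hR.symm

end Summit.NavierStokesRegularity.NavierStokesRegularity.Theorems.BoundedEnvelope

end
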